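import Summits.AtomisticToContinuum.Crystallization.Theorems.HullExactificationCascadeRobustBarlowTemplateTransportDefs
import Summits.AtomisticToContinuum.Crystallization.Theorems.HullExactificationCascadeRobustBarlowTemplateDevelopCharts
import Summits.AtomisticToContinuum.Crystallization.Theorems.HullExactificationCascadeRobustBarlowTemplateStubReciprocity
import Mathlib.Topology.Covering.Basic
import Mathlib.Topology.Homotopy.Lifting
import Mathlib.Analysis.InnerProductSpace.EuclideanDist
import Mathlib.Topology.Homotopy.Contractible
import Mathlib.Analysis.Convex.Contractible

/-!
# `develop_coveringCriterion` for line `registered` (crux `RobustBarlowTemplate`, stmt-AtomisticToContinuum-12088)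

**Statement.** A continuous open self-map `f` of `ℝ³` which is injective on every `r`-ball and
whose images of `r`-balls contain the concentric `c`-balls (`0 < r`, `0 < c`) is a bijection.

**Proof outline.**
* `criterion_isCoveringMap_of_uniform` — such an `f` is a covering map of `ℝ³`
  (Browder 1954 / Plastock 1974 / F. John 1968): it is onto (the range is open, and closed because
  a limit of image points lies in a `c`-ball around an image point, hence is an image point);
  fibres are `r`-separated hence discrete; over `W = ball y c` the sheets `ball e r ∩ f⁻¹ W`,
  `e ∈ f⁻¹ y`, are pairwise disjoint, cover `f⁻¹ W` and map homeomorphically onto `W`;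
  Mathlib's `IsOpen.trivializationDiscrete` assembles the even covering.
* `criterion_bijective_of_isCoveringMap` — a covering map `ℝ³ → ℝ³` is bijective (monodromy on
  the simply connected `ℝ³`: lift `id` through `f` to a section `s`; `s ∘ f` and `id` are two
  lifts of `f` through `f` agreeing at one point).
* `develop_coveringCriterion` composes the two.

Both helpers are adapted (essentially verbatim) from the sibling crux workfile
`Cruxes/ShellsToBarlowChart/Lines/straightening-development.lean`
(`isCoveringMap_of_uniform`, `bijective_of_isCoveringMap`), which is not importable from
`Theorems/`.
-/

noncomputable section

namespace Summit.AtomisticToContinuum.Crystallization.Theorems.HullExactificationCascadeRobustBarlowTemplate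

open Literature.MathematicalPhysics.StatisticalMechanics Literature.Geometry.DiscreteGeometry
open Summit.AtomisticToContinuum.Crystallization.Theorems.PalmUnimodularRigidityShellsToBarlowChart
  (contacts fcc3Int)
open RealInnerProductSpace

/-- Euclidean `3`-space. -/
local notation "E3" => EuclideanSpace ℝ (Fin 3)

section Criterion

open Set Function Filter Metric Topology

-- adapted from Cruxes/ShellsToBarlowChart/Lines/straightening-development.lean
-- (isCoveringMap_of_uniform, bijective_of_isCoveringMap)

/-- **Covering criterion** (Browder 1954 / Plastock 1974 / F. John 1968 in classical dress).
A continuous open self-map of `ℝ³` which is injective on every `r`-ball and whose images of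
`r`-balls contain the concentric `c`-balls is a covering map: it is onto (the range is open, and
closed because a limit of image points lies in a `c`-ball around an image point); fibres are
`r`-separated hence discrete; over `W = ball y c` the sheets `ball e r ∩ f⁻¹ W`, `e ∈ f⁻¹ y`, are
pairwise disjoint (two of them meeting at `z` put both `e`'s in `ball z r`, contradicting `hinj`),
cover `f⁻¹ W` (`hsur` at `z` puts a fibre point in `ball z r`) and map homeomorphically onto `W`
(continuous, open, injective; onto by `hsur` at `e`); Mathlib's `IsOpen.trivializationDiscrete`
assembles the even covering. [folklore] -/
theorem criterion_isCoveringMap_of_uniform (f : E3 → E3) (r c : ℝ) (hf : Continuous f)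
    (ho : IsOpenMap f) (hr : 0 < r) (hc : 0 < c) (hinj : ∀ p : E3, InjOn f (ball p r))
    (hsur : ∀ p : E3, ball (f p) c ⊆ f '' ball p r) : IsCoveringMap f := by
  -- `f` is onto: the range is open and closed
  have hsurj : Surjective f := by
    have hopen : IsOpen (range f) := ho.isOpen_range
    have hclosed : IsClosed (range f) := by
      rw [← isOpen_compl_iff, isOpen_iff_mem_nhds]
      intro y hy
      refine mem_of_superset (isOpen_ball.mem_nhds (mem_ball_self hc)) fun x hx hxr => ?_
      obtain ⟨z, rfl⟩ := hxr
      have hy' : y ∈ ball (f z) c := by rw [mem_ball, dist_comm]; exact hx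
      obtain ⟨w, -, hw⟩ := hsur z hy'
      exact hy ⟨w, hw⟩
    exact Set.range_eq_univ.1 (IsClopen.eq_univ ⟨hclosed, hopen⟩ (range_nonempty f))
  intro q
  -- the fibre over `q` is discrete and nonempty
  haveI : DiscreteTopology (f ⁻¹' {q}) := by
    refine (isDiscrete_iff_forall_mem_exists_isOpen.mpr fun e he => ?_).to_subtype
    refine ⟨ball e r, isOpen_ball,
      subset_antisymm ?_ (singleton_subset_iff.mpr ⟨mem_ball_self hr, he⟩)⟩
    rintro e' ⟨he'b, he'⟩
    have h1 : f e' = f e := by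
      rw [mem_preimage, mem_singleton_iff] at he he'
      rw [he, he']
    exact mem_singleton_iff.mpr (hinj e he'b (mem_ball_self hr) h1)
  haveI : Nonempty (f ⁻¹' {q}) := by
    obtain ⟨α, hα⟩ := hsurj q
    exact ⟨⟨α, hα⟩⟩
  set V : Set E3 := ball q c with hV
  set U : (f ⁻¹' {q}) → Set E3 := fun α => ball (α : E3) r ∩ f ⁻¹' V with hU
  have hfα : ∀ α : f ⁻¹' {q}, f α = q := fun α => α.2
  -- points of `V` lift into each sheet
  have hlift : ∀ (α : f ⁻¹' {q}), ∀ x ∈ V, ∃ z ∈ U α, f z = x := by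
    intro α x hx
    have hx' : x ∈ ball (f (α : E3)) c := by rw [hfα]; exact hx
    obtain ⟨z, hz, hzx⟩ := hsur α hx'
    refine ⟨z, ⟨hz, ?_⟩, hzx⟩
    show f z ∈ V
    rw [hzx]; exact hx
  have hopen_iff : ∀ α {W : Set E3}, W ⊆ V → (IsOpen W ↔ IsOpen (f ⁻¹' W ∩ U α)) := by
    intro α W hWV
    refine ⟨fun hW => (hW.preimage hf).inter (isOpen_ball.inter (isOpen_ball.preimage hf)),
      fun hW' => ?_⟩
    have himage : f '' (f ⁻¹' W ∩ U α) = W := by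
      apply subset_antisymm
      · rintro _ ⟨z, ⟨hzW, -⟩, rfl⟩
        exact hzW
      · intro x hxW
        obtain ⟨z, hzU, hzx⟩ := hlift α x (hWV hxW)
        refine ⟨z, ⟨?_, hzU⟩, hzx⟩
        show f z ∈ W
        rw [hzx]; exact hxW
    rw [← himage]
    exact ho _ hW'
  have hinjU : ∀ α, (U α).InjOn f := fun α => (hinj (α : E3)).mono inter_subset_left
  have hsurjOn : ∀ α, (U α).SurjOn f V := fun α x hx => hlift α x hx
  have hdisj : Pairwise (Disjoint on U) := by
    intro α β hne
    refine Set.disjoint_left.2 fun z hzα hzβ => hne ?_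
    have hα : (α : E3) ∈ ball z r := by rw [mem_ball, dist_comm]; exact hzα.1
    have hβ : (β : E3) ∈ ball z r := by rw [mem_ball, dist_comm]; exact hzβ.1
    exact Subtype.ext (hinj z hα hβ (by rw [hfα, hfα]))
  have hexh : f ⁻¹' V ⊆ ⋃ α, U α := by
    intro z hz
    have hq : q ∈ ball (f z) c := by rw [mem_ball, dist_comm]; exact hz
    obtain ⟨α, hα, hαq⟩ := hsur z hq
    have hzα : z ∈ ball α r := by rw [mem_ball, dist_comm]; exact hα
    exact mem_iUnion.2 ⟨⟨α, hαq⟩, hzα, hz⟩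
  exact IsEvenlyCovered.of_trivialization
    (t := IsOpen.trivializationDiscrete U V isOpen_ball hopen_iff hinjU hsurjOn hdisj hexh)
    (mem_ball_self hc)

/-- **A covering map `ℝ³ → ℝ³` is bijective** (monodromy: lift `id` through `f` to a section
`s`, `f ∘ s = id`; `s ∘ f` and `id` are two lifts of `f` through `f` agreeing at one point, so
`s ∘ f = id`). [folklore] -/
theorem criterion_bijective_of_isCoveringMap {f : E3 → E3} (hf : IsCoveringMap f) :
    Bijective f := by
  haveI : ContractibleSpace E3 := RealTopologicalVectorSpace.contractibleSpace
  haveI : SimplyConnectedSpace E3 := inferInstance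
  obtain ⟨s, ⟨hs₀, hs⟩, -⟩ :=
    hf.existsUnique_continuousMap_lifts (ContinuousMap.id E3) (f 0) 0 rfl
  have hs' : f ∘ (s : E3 → E3) = id := hs
  have hsec : (s : E3 → E3) ∘ f = id := by
    refine hf.eq_of_comp_eq (s.continuous.comp hf.continuous) continuous_id ?_ 0 ?_
    · change (f ∘ (s : E3 → E3)) ∘ f = f ∘ id
      rw [hs']
      rfl
    · simp [hs₀]
  exact ⟨LeftInverse.injective (g := s) fun m => congrFun hsec m,
    RightInverse.surjective (g := s) fun y => congrFun hs' y⟩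

end Criterion

/-- SUB-GOAL `develop_coveringCriterion` (registered on stmt-12088; the closer of
`develop_injective`): a continuous open self-map of `ℝ³` which is injective on every `r`-ball and
whose images of `r`-balls contain the concentric `c`-balls is a bijection (it is a covering map of
the simply connected `ℝ³`, `criterion_isCoveringMap_of_uniform`, and covering maps of `ℝ³` onto
itself are bijective by monodromy, `criterion_bijective_of_isCoveringMap`). -/
theorem develop_coveringCriterion :
    ∀ (f : E3 → E3) (r c : ℝ), Continuous f → IsOpenMap f → 0 < r → 0 < c →
      (∀ p : E3, Set.InjOn f (Metric.ball p r)) →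
      (∀ p : E3, Metric.ball (f p) c ⊆ f '' Metric.ball p r) → Function.Bijective f :=
  fun f r c hf ho hr hc hinj hsur =>
    criterion_bijective_of_isCoveringMap
      (criterion_isCoveringMap_of_uniform f r c hf ho hr hc hinj hsur)

end Summit.AtomisticToContinuum.Crystallization.Theorems.HullExactificationCascadeRobustBarlowTemplate

end
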